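import Summits.BirchSwinnertonDyer.BirchSwinnertonDyer.Theorems.PrintX9MuPartStubH5bAtSFrameOfClauseZero
import Literature.NumberTheory.EllipticCurves.ZpExtensionEisensteinSelmerH5bOrdinaryPlacesProofs
import Literature.NumberTheory.EllipticCurves.ZpExtensionEisensteinDVRSettingH4BadPlacesUniformProofs
import Literature.NumberTheory.EllipticCurves.OrdinaryReductionAscentProofs
import Literature.NumberTheory.EllipticCurves.TorsionFilAtCyclicOfFrobeniusTraceProofs
import HarnessLib

/-!
# `Stmt.h5bAtS` of the shared μ-crux ON THE NON-ANOMALOUS FRAMES: Howard's H.5(b) for the curve's Eisenstein setting,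
# complete in the kernel on every `Thm413Hypotheses` frame whose places above `p` are non-anomalous (R2's partial discharge
# at the level of the letter)

Summits-side helper for the line `spec_witnesses` on the shared μ-crux `MuInequalityCoherentPairOfPrint`
(stmt-BirchSwinnertonDyer-23237, registered stub `stub_h5bAtS : Stmt.h5bAtS`); cell `pub/bsd-print-x9`, seat
`bsd-line-x10b-p1-w8` g3 (the `k = 0` assembler lineage).  `--supports` stmt-BirchSwinnertonDyer-23237.  THEOREMS ONLY.

LEAD `bsd-line-x10b-p1` g8, ruling (R2) (STATUS 20:16:54Z): the letter `Stmt.h5bAtS` quantifies over ALL `Thm413Hypotheses`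
frames (138/313 of the X10b pairs are anomalous at a place above `p`), so no «non-anomalous» hypothesis may enter it; the
non-anomalous case is landed as a PARTIAL discharge with explicit per-place hypotheses.  x10b-p1-w8 g2 did so at the
Literature level (`WeierstrassCurve.eisensteinDVRSetting_h5b_clause_zero_of_mem_of_nonanomalous`, p668203: the `v ∣ p` clause
at tower level `0` given good reduction, an ordinary point and the two non-anomalous inputs (hna0)/(hna2) at `w = v, σ v`).
This file lifts it to the letter, ONE FRAME AT A TIME:
* **`clauseZeroP_frame_of_nonanomalous`** — on a frame of the μ-letter whose places `w ∈ S` above `p` satisfy (hna0)/(hna2),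
  the level-`0` clause above `p` (the hypothesis `H5Pf` of `h5bAtS_frame_of_clauseZeroP`, threshold `m₁ = 0`): the frame
  supplies good reduction at `w ∣ p` (`hasGoodReductionAt_baseChange_of_hasGoodReductionAtPrime hyp.ordinary.1`, x10b-p1-w2's
  ordinary ascent), the ordinary point (`exists_ordinaryPoint_local_of_not_dvd_frobeniusTraceAt` ∘
  `not_dvd_frobeniusTraceAt_baseChange_of_isOrdinaryAt hyp.ordinary`), `p ∈ σ v` (`natCast_mem_smul_asIdeal_iff`) and
  `σ v ∈ S` (`σ² = 1`);
* **`h5bAtS_frame_of_nonanomalous`** — hence that frame's instance of `Stmt.h5bAtS` (one `m₅`, all data, all levels `k`,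
  all `v ∈ S`), by `h5bAtS_frame_of_clauseZeroP` (x10b-p1-w8 g3: uniform `v ∤ p` clause + level lift).
WHAT REMAINS for the registered stub: the anomalous places above `p` ((H5B-P-ANOM): road U of x9-p1-w3 g6 / road E).
HONEST FRAMING: nothing is claimed on anomalous frames; no summit statement is proved; the μ-crux is not asserted; BSD is not
proved by any of this.

References: [Howard2004HeegnerKolyvagin] §1.3 H.5(b), Def. 3.1.2, §3.1, Lemma 3.2.7 (arXiv:1202.6340 p. 7 L96–97, p. 15–16);
[GreenbergLNM1716] §1 p. 62, §2; [SilvermanAEC2009] Thm. V.2.3.1, Prop. VII.5.1(a); [CastellaGrossiLeeSkinner2022] §3.2, §3.4;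
[MazurRubinMemoirs2004] Def. 1.1.1, Example 1.1.2.
-/

set_option linter.dupNamespace false
set_option autoImplicit false

noncomputable section

open scoped Classical Pointwise ContRepresentation TensorProduct NumberField

open Function NumberField IsDedekindDomain Field
open Literature Literature.NumberTheory.EllipticCurves WeierstrassCurve
open Literature.NumberTheory.GaloisCohomology Literature.NumberTheory.GaloisCohomology.Howard2004
open Literature.NumberTheory.Automorphic
open Literature.NumberTheory.GaloisRepresentations Literature.NumberTheory.GaloisRepresentations.DiscreteGaloisModule
open Summit.BirchSwinnertonDyer.BirchSwinnertonDyer.Theorems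

namespace Summit.BirchSwinnertonDyer.BirchSwinnertonDyer.Theorems.HeegnerMuPartH5bAtS

set_option synthInstance.maxHeartbeats 80000 in
/-- **The level-`0` clause of H.5(b) above `p` on a NON-ANOMALOUS frame of the μ-letter** (hypothesis `H5Pf` of
`h5bAtS_frame_of_clauseZeroP`, threshold `m₁ = 0`): on a `Thm413Hypotheses` frame whose places `w ∈ S` above `p` carry the
per-place non-anomalous inputs (hna0) «some `σ₀ ∈ Γ_{K_w}` acts on `E[p]` mod `Fil_w E[p]` as `n₀ ≢ 1 (mod p)`» and (hna2)
«every `Γ_{K_w}`-equivariant additive `Fil_w E[p] → μ_p` is zero», for every `v ∈ S` above `p`, every `m ≥ 1` and all the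
data of the canonical Eisenstein setting, `(θ_v ∘ transport_v)(F̄_0(σ v)) = F̄_0(v)` — x10b-p1-w8 g2's
`eisensteinDVRSetting_h5b_clause_zero_of_mem_of_nonanomalous` with `hgood`/`hord` discharged from `hyp.ordinary`
(good ORDINARY reduction of `E/ℚ` at `p` ascends to every `w ∣ p` of `K`).
[cite: Howard2004HeegnerKolyvagin, §1.3 H.5(b), Def. 3.1.2, §3.1 and Lemma 3.2.7 (arXiv:1202.6340 p. 7 L96–97, p. 15 L56–66, p. 16 L150–160)]
[cite: GreenbergLNM1716, §1 p. 62 and §2] [cite: SilvermanAEC2009, Thm. V.2.3.1 and Prop. VII.5.1(a)] -/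
theorem clauseZeroP_frame_of_nonanomalous
    (N : ℕ) [NeZero N] (W : WeierstrassCurve ℚ) [W.IsGloballyMinimal] (K : Type) [Field K] [NumberField K]
    (p : ℕ) [Fact p.Prime] (κ : ZpExtension K p) (γ : Field.absoluteGaloisGroup K)
    (hyp : CastellaGrossiLeeSkinner2022.Thm413Hypotheses N W K p κ γ)
    (_hirr : W.HasIrreducibleModPGaloisRep p) (_hirrK : (W.baseChange K).HasIrreducibleModPGaloisRep p)
    (S : Finset (HeightOneSpectrum (𝓞 K)))
    (hpS : ∀ v, ((p : ℕ) : 𝓞 K) ∈ v.asIdeal → v ∈ S)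
    (hbad : haveI := hyp.isElliptic
      ∀ v, v ∉ S → ((p : ℕ) : 𝓞 K) ∉ v.asIdeal → (W.baseChange K).HasGoodReductionAt v)
    (_hSN : ∀ v ∈ S, ((p : ℕ) : 𝓞 K) ∈ v.asIdeal ∨ ((N : ℕ) : 𝓞 K) ∈ v.asIdeal)
    (hSσ : ∀ (σ : K ≃ₐ[ℚ] K) (v : HeightOneSpectrum (𝓞 K)), σ • v ∈ S → v ∈ S)
    (NA0 : haveI := hyp.isElliptic
      ∀ w ∈ S, ((p : ℕ) : 𝓞 K) ∈ w.asIdeal →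
        ∃ (σ₀ : absoluteGaloisGroup (w.adicCompletion K)) (n₀ : ℤ), ¬ (p : ℤ) ∣ n₀ - 1 ∧
          ∀ a : geomTorsion (W.baseChange K) ((p : ℤ) ^ 1),
            GaloisRep.toLocal w ((W.baseChange K).torsionGaloisModule ((p : ℤ) ^ 1)) σ₀ a - n₀ • a ∈
              ((W.baseChange K).ordinaryFiltrationAt w (fun j ↦ (W.baseChange K).torsionGaloisModuleReduce p j)
                (fun _ _ ↦ rfl)).fil 1)
    (NA2 : haveI := hyp.isElliptic
      ∀ w ∈ S, ((p : ℕ) : 𝓞 K) ∈ w.asIdeal →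
        ∀ g : ((W.baseChange K).ordinaryFiltrationAt w (fun j ↦ (W.baseChange K).torsionGaloisModuleReduce p j)
            (fun _ _ ↦ rfl)).fil 1 →+ MuCarrier (w.adicCompletion K) (p ^ 1),
          (∀ (σ' : absoluteGaloisGroup (w.adicCompletion K))
            (a : ((W.baseChange K).ordinaryFiltrationAt w (fun j ↦ (W.baseChange K).torsionGaloisModuleReduce p j)
              (fun _ _ ↦ rfl)).fil 1),
            g ⟨GaloisRep.toLocal w ((W.baseChange K).torsionGaloisModule ((p : ℤ) ^ 1)) σ' a,
              ((W.baseChange K).ordinaryFiltrationAt w (fun j ↦ (W.baseChange K).torsionGaloisModuleReduce p j)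
                (fun _ _ ↦ rfl)).smul_mem 1 σ' a a.2⟩ = mu (w.adicCompletion K) (p ^ 1) σ' (g a)) → g = 0) :
    haveI := hyp.isElliptic
    ∀ v ∈ S, ((p : ℕ) : 𝓞 K) ∈ v.asIdeal →
    ∃ m₁ : ℕ, ∀ (m : ℕ) (hm : 1 ≤ m), m₁ < m →
      letI := IwasawaAlgebra.isDomain_quotient_X_pow_add_C p hm
      letI := IwasawaAlgebra.isDiscreteValuationRing_quotient_X_pow_add_C p hm
      haveI := IwasawaAlgebra.EisensteinCoeff.isLocalRing_succ p hm
      letI := IwasawaAlgebra.EisensteinCoeff.algebraOfSpecSucc p m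
      haveI := W.isScalarTower_algebraOfSpecSucc (K := K) (p := p) (m := m)
      letI := W.residueModuleSucc (K := K) (p := p) hm
      ∀ (π : ∀ v : HeightOneSpectrum (𝓞 K), TamePin v) (L : Set (HeightOneSpectrum (𝓞 K)))
        (hL : L ⊆ (W.eisensteinTower (κ.unitTwist (-1)) hm).degreeTwoPrimes p) (hLS : ∀ v ∈ L, v ∉ S)
        (jbar' : AlgebraicClosure K →+* ℂ)
        (c₀ : absoluteGaloisGroup ℚ) (σ : K ≃ₐ[ℚ] K) (hσ₁ : σ ≠ 1) (hσ : σ * σ = 1)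
        (hτl : IsLiftOfAut σ (absGaloisTransport (K := ℚ) (L := K) c₀).toRingEquiv)
        (hτ₂ : Function.Involutive (absGaloisTransport (K := ℚ) (L := K) c₀).toRingEquiv)
        (D : ∀ k, DualityDatum p (ConjugationDatum.ofLifts σ hσ₁ hσ _ hτl hτ₂)
          ((W.eisensteinTower (κ.unitTwist (-1)) hm).ρ k) (IwasawaAlgebra.EisensteinCoeff p m (k + 1)))
        (e : ∀ j : ℕ, geomTorsion (W.baseChange K) ((p : ℤ) ^ j) →+ geomTorsion (W.baseChange K) ((p : ℤ) ^ j) →+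
          MuCarrier K (p ^ j))
        (log : ∀ j : ℕ, MuCarrier K (p ^ j) →+ ZMod (p ^ j)),
        IsComplexConjugation (Rat.castHom ℝ) c₀ →
        (∀ x, (ConjugationDatum.ofLifts σ hσ₁ hσ _ hτl hτ₂).τ x = absGaloisTransport (K := ℚ) (L := K) c₀ x) →
        (∀ k, (D k).e = ZpExtension.eisensteinDualityForm hm (k + 1)
          (conjPairing (e (k + 1)) ((ConjugationDatum.ofLifts σ hσ₁ hσ _ hτl hτ₂).isLift.torsionMap W _)
            (log (k + 1)))) →
        (∀ j a, e j a a = 0) →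
        (∀ j (g : absoluteGaloisGroup K) a b, e j (g • a) (g • b) = mu K (p ^ j) g (e j a b)) →
        (∀ j a b, e j ((ConjugationDatum.ofLifts σ hσ₁ hσ _ hτl hτ₂).isLift.torsionMap W _ a)
          ((ConjugationDatum.ofLifts σ hσ₁ hσ _ hτl hτ₂).isLift.torsionMap W _ b) = -e j a b) →
        (∀ j (a : geomTorsion (W.baseChange K) ((p : ℤ) ^ j)),
          (ConjugationDatum.ofLifts σ hσ₁ hσ _ hτl hτ₂).isLift.torsionMap W _
            ((ConjugationDatum.ofLifts σ hσ₁ hσ _ hτl hτ₂).isLift.torsionMap W _ a) = a) →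
        (∀ j, Function.Bijective (log j)) →
        (∀ j (g : absoluteGaloisGroup K) ξ, log j (mu K (p ^ j) g ξ) = cyclotomicCharacterModPow K p j g * log j ξ) →
          (((W.isQuotientBy_eisensteinDVRSetting_πbar (κ.unitTwist (-1)) hm S hpS hbad L hL hLS jbar'
              (ConjugationDatum.ofLifts σ hσ₁ hσ _ hτl hτ₂) D
              (W.eisensteinLevelsTameFs (κ.unitTwist (-1)) hm π S hpS hbad L hL hLS)
              0).propagateStructure (W.eisensteinTowerTriple (κ.unitTwist (-1)) hm S hpS hbad L hL hLS 0).cond)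
              (Sum.inr (σ • v))).map
              (((W.residualTauGeomTorsion (p := p) (ConjugationDatum.ofLifts σ hσ₁ hσ _ hτl hτ₂) hm (k := 0 + 1)
                  (Nat.succ_pos 0)).thetaH1 (Sum.inr v)).comp
                ((ConjugationDatum.ofLifts σ hσ₁ hσ _ hτl hτ₂).transportH1
                  ((W.baseChange K).torsionGaloisModule (p : ℤ)) v)) =
            ((W.isQuotientBy_eisensteinDVRSetting_πbar (κ.unitTwist (-1)) hm S hpS hbad L hL hLS jbar'
              (ConjugationDatum.ofLifts σ hσ₁ hσ _ hτl hτ₂) D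
              (W.eisensteinLevelsTameFs (κ.unitTwist (-1)) hm π S hpS hbad L hL hLS)
              0).propagateStructure (W.eisensteinTowerTriple (κ.unitTwist (-1)) hm S hpS hbad L hL hLS 0).cond)
              (Sum.inr v) := by
  haveI := hyp.isElliptic
  intro v hvS hpv
  refine ⟨0, fun m hm _ ↦ ?_⟩
  letI := IwasawaAlgebra.isDomain_quotient_X_pow_add_C p hm
  letI := IwasawaAlgebra.isDiscreteValuationRing_quotient_X_pow_add_C p hm
  haveI := IwasawaAlgebra.EisensteinCoeff.isLocalRing_succ p hm
  letI := IwasawaAlgebra.EisensteinCoeff.algebraOfSpecSucc p m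
  haveI := W.isScalarTower_algebraOfSpecSucc (K := K) (p := p) (m := m)
  letI := W.residueModuleSucc (K := K) (p := p) hm
  intro π L hL hLS jbar' c₀ σ hσ₁ hσ hτl hτ₂ D e log hc₀ hτ hDe h4' h5' h6' h7' h8' h9'
  -- `σ v ∈ S`, `p ∈ σ v`
  have hσvS : σ • v ∈ S := hSσ σ _ (by rwa [smul_smul, hσ, one_smul])
  have hpσv : ((p : ℕ) : 𝓞 K) ∈ (σ • v).asIdeal := (natCast_mem_smul_asIdeal_iff (K := K) (p := p) σ v).2 hpv
  -- the two places `w ∈ {v, σ v}` lie in `S` above `p`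
  have hloc : ∀ w ∈ ({v, (ConjugationDatum.ofLifts σ hσ₁ hσ _ hτl hτ₂).σ • v} : Set (HeightOneSpectrum (𝓞 K))),
      w ∈ S ∧ ((p : ℕ) : 𝓞 K) ∈ w.asIdeal := by
    intro w hw
    rcases hw with hw | hw
    · rw [hw]
      exact ⟨hvS, hpv⟩
    · rw [Set.mem_singleton_iff] at hw
      rw [hw]
      exact ⟨hσvS, hpσv⟩
  -- good ORDINARY reduction of `E_K` at `w ∣ p`, from `hyp.ordinary`
  have hgood : ∀ w ∈ ({v, (ConjugationDatum.ofLifts σ hσ₁ hσ _ hτl hτ₂).σ • v} : Set (HeightOneSpectrum (𝓞 K))),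
      (W.baseChange K).HasGoodReductionAt w :=
    fun w hw ↦ W.hasGoodReductionAt_baseChange_of_hasGoodReductionAtPrime hyp.ordinary.1 w (hloc w hw).2
  have hord : ∀ w ∈ ({v, (ConjugationDatum.ofLifts σ hσ₁ hσ _ hτl hτ₂).σ • v} : Set (HeightOneSpectrum (𝓞 K))),
      ∃ P : localPoints (W.baseChange K) (w.adicCompletion K),
        (p : ℤ) • P = 0 ∧ P ∉ (W.baseChange K).localKernelOfReduction w :=
    fun w hw ↦ (W.baseChange K).exists_ordinaryPoint_local_of_not_dvd_frobeniusTraceAt w (hgood w hw) (hloc w hw).2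
      (W.not_dvd_frobeniusTraceAt_baseChange_of_isOrdinaryAt hyp.ordinary w (hloc w hw).2)
  exact W.eisensteinDVRSetting_h5b_clause_zero_of_mem_of_nonanomalous (κ.unitTwist (-1)) hm S hpS hbad L hL hLS jbar'
    σ hσ₁ hσ _ hτl hτ₂ D (W.eisensteinLevelsTameFs (κ.unitTwist (-1)) hm π S hpS hbad L hL hLS) hpv hpσv hgood hord
    (fun w hw ↦ NA0 w (hloc w hw).1 (hloc w hw).2) (fun w hw ↦ NA2 w (hloc w hw).1 (hloc w hw).2)

set_option synthInstance.maxHeartbeats 80000 in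
/-- **`Stmt.h5bAtS` on a non-anomalous frame**: on a `Thm413Hypotheses` frame of the μ-letter (`(irr_ℚ)`, `(irr_K)`,
`S ⊇ {v ∣ p}` inside `{v ∣ pN}` and `Aut(K/ℚ)`-stable) whose places above `p` satisfy (hna0)/(hna2), Howard's H.5(b) for
the curve's Eisenstein setting holds in the letter's form: ONE threshold `m₅`, then for all the data of the canonical setting,
every tower level `k` and every `v ∈ S`, `(θ_v ∘ transport_v)(F̄_k(σ v)) = F̄_k(v)` — `h5bAtS_frame_of_clauseZeroP` (uniform
`v ∤ p` clause, level lift) fed with `clauseZeroP_frame_of_nonanomalous`.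
[cite: Howard2004HeegnerKolyvagin, §1.3 H.5(b) (arXiv:1202.6340 p. 7 L96–97), §1.6 (p. 12 L29–55), §2.2, Def. 3.1.2, Lemma 3.2.7]
[cite: CastellaGrossiLeeSkinner2022, §3.2 and §3.4] [cite: GreenbergLNM1716, §2] -/
theorem h5bAtS_frame_of_nonanomalous
    (N : ℕ) [NeZero N] (W : WeierstrassCurve ℚ) [W.IsGloballyMinimal] (K : Type) [Field K] [NumberField K]
    (p : ℕ) [Fact p.Prime] (κ : ZpExtension K p) (γ : Field.absoluteGaloisGroup K)
    (hyp : CastellaGrossiLeeSkinner2022.Thm413Hypotheses N W K p κ γ)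
    (_hirr : W.HasIrreducibleModPGaloisRep p) (_hirrK : (W.baseChange K).HasIrreducibleModPGaloisRep p)
    (S : Finset (HeightOneSpectrum (𝓞 K)))
    (hpS : ∀ v, ((p : ℕ) : 𝓞 K) ∈ v.asIdeal → v ∈ S)
    (hbad : haveI := hyp.isElliptic
      ∀ v, v ∉ S → ((p : ℕ) : 𝓞 K) ∉ v.asIdeal → (W.baseChange K).HasGoodReductionAt v)
    (hSN : ∀ v ∈ S, ((p : ℕ) : 𝓞 K) ∈ v.asIdeal ∨ ((N : ℕ) : 𝓞 K) ∈ v.asIdeal)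
    (hSσ : ∀ (σ : K ≃ₐ[ℚ] K) (v : HeightOneSpectrum (𝓞 K)), σ • v ∈ S → v ∈ S)
    (NA0 : haveI := hyp.isElliptic
      ∀ w ∈ S, ((p : ℕ) : 𝓞 K) ∈ w.asIdeal →
        ∃ (σ₀ : absoluteGaloisGroup (w.adicCompletion K)) (n₀ : ℤ), ¬ (p : ℤ) ∣ n₀ - 1 ∧
          ∀ a : geomTorsion (W.baseChange K) ((p : ℤ) ^ 1),
            GaloisRep.toLocal w ((W.baseChange K).torsionGaloisModule ((p : ℤ) ^ 1)) σ₀ a - n₀ • a ∈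
              ((W.baseChange K).ordinaryFiltrationAt w (fun j ↦ (W.baseChange K).torsionGaloisModuleReduce p j)
                (fun _ _ ↦ rfl)).fil 1)
    (NA2 : haveI := hyp.isElliptic
      ∀ w ∈ S, ((p : ℕ) : 𝓞 K) ∈ w.asIdeal →
        ∀ g : ((W.baseChange K).ordinaryFiltrationAt w (fun j ↦ (W.baseChange K).torsionGaloisModuleReduce p j)
            (fun _ _ ↦ rfl)).fil 1 →+ MuCarrier (w.adicCompletion K) (p ^ 1),
          (∀ (σ' : absoluteGaloisGroup (w.adicCompletion K))
            (a : ((W.baseChange K).ordinaryFiltrationAt w (fun j ↦ (W.baseChange K).torsionGaloisModuleReduce p j)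
              (fun _ _ ↦ rfl)).fil 1),
            g ⟨GaloisRep.toLocal w ((W.baseChange K).torsionGaloisModule ((p : ℤ) ^ 1)) σ' a,
              ((W.baseChange K).ordinaryFiltrationAt w (fun j ↦ (W.baseChange K).torsionGaloisModuleReduce p j)
                (fun _ _ ↦ rfl)).smul_mem 1 σ' a a.2⟩ = mu (w.adicCompletion K) (p ^ 1) σ' (g a)) → g = 0) :
    haveI := hyp.isElliptic
    ∃ m₅ : ℕ, ∀ (m : ℕ) (hm : 1 ≤ m), m₅ ≤ m →
      letI := IwasawaAlgebra.isDomain_quotient_X_pow_add_C p hm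
      letI := IwasawaAlgebra.isDiscreteValuationRing_quotient_X_pow_add_C p hm
      haveI := IwasawaAlgebra.EisensteinCoeff.isLocalRing_succ p hm
      letI := IwasawaAlgebra.EisensteinCoeff.algebraOfSpecSucc p m
      haveI := W.isScalarTower_algebraOfSpecSucc (K := K) (p := p) (m := m)
      letI := W.residueModuleSucc (K := K) (p := p) hm
      ∀ (π : ∀ v : HeightOneSpectrum (𝓞 K), TamePin v) (L : Set (HeightOneSpectrum (𝓞 K)))
        (hL : L ⊆ (W.eisensteinTower (κ.unitTwist (-1)) hm).degreeTwoPrimes p) (hLS : ∀ v ∈ L, v ∉ S)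
        (jbar' : AlgebraicClosure K →+* ℂ)
        (c₀ : absoluteGaloisGroup ℚ) (σ : K ≃ₐ[ℚ] K) (hσ₁ : σ ≠ 1) (hσ : σ * σ = 1)
        (hτl : IsLiftOfAut σ (absGaloisTransport (K := ℚ) (L := K) c₀).toRingEquiv)
        (hτ₂ : Function.Involutive (absGaloisTransport (K := ℚ) (L := K) c₀).toRingEquiv)
        (D : ∀ k, DualityDatum p (ConjugationDatum.ofLifts σ hσ₁ hσ _ hτl hτ₂)
          ((W.eisensteinTower (κ.unitTwist (-1)) hm).ρ k) (IwasawaAlgebra.EisensteinCoeff p m (k + 1)))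
        (e : ∀ j : ℕ, geomTorsion (W.baseChange K) ((p : ℤ) ^ j) →+ geomTorsion (W.baseChange K) ((p : ℤ) ^ j) →+
          MuCarrier K (p ^ j))
        (log : ∀ j : ℕ, MuCarrier K (p ^ j) →+ ZMod (p ^ j)),
        IsComplexConjugation (Rat.castHom ℝ) c₀ →
        (∀ x, (ConjugationDatum.ofLifts σ hσ₁ hσ _ hτl hτ₂).τ x = absGaloisTransport (K := ℚ) (L := K) c₀ x) →
        (∀ k, (D k).e = ZpExtension.eisensteinDualityForm hm (k + 1)
          (conjPairing (e (k + 1)) ((ConjugationDatum.ofLifts σ hσ₁ hσ _ hτl hτ₂).isLift.torsionMap W _)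
            (log (k + 1)))) →
        (∀ j a, e j a a = 0) →
        (∀ j (g : absoluteGaloisGroup K) a b, e j (g • a) (g • b) = mu K (p ^ j) g (e j a b)) →
        (∀ j a b, e j ((ConjugationDatum.ofLifts σ hσ₁ hσ _ hτl hτ₂).isLift.torsionMap W _ a)
          ((ConjugationDatum.ofLifts σ hσ₁ hσ _ hτl hτ₂).isLift.torsionMap W _ b) = -e j a b) →
        (∀ j (a : geomTorsion (W.baseChange K) ((p : ℤ) ^ j)),
          (ConjugationDatum.ofLifts σ hσ₁ hσ _ hτl hτ₂).isLift.torsionMap W _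
            ((ConjugationDatum.ofLifts σ hσ₁ hσ _ hτl hτ₂).isLift.torsionMap W _ a) = a) →
        (∀ j, Function.Bijective (log j)) →
        (∀ j (g : absoluteGaloisGroup K) ξ, log j (mu K (p ^ j) g ξ) = cyclotomicCharacterModPow K p j g * log j ξ) →
        ∀ k, ∀ v ∈ S,
          (((W.isQuotientBy_eisensteinDVRSetting_πbar (κ.unitTwist (-1)) hm S hpS hbad L hL hLS jbar'
              (ConjugationDatum.ofLifts σ hσ₁ hσ _ hτl hτ₂) D
              (W.eisensteinLevelsTameFs (κ.unitTwist (-1)) hm π S hpS hbad L hL hLS)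
              k).propagateStructure (W.eisensteinTowerTriple (κ.unitTwist (-1)) hm S hpS hbad L hL hLS k).cond)
              (Sum.inr (σ • v))).map
              (((W.residualTauGeomTorsion (p := p) (ConjugationDatum.ofLifts σ hσ₁ hσ _ hτl hτ₂) hm (k := k + 1)
                  k.succ_pos).thetaH1 (Sum.inr v)).comp
                ((ConjugationDatum.ofLifts σ hσ₁ hσ _ hτl hτ₂).transportH1
                  ((W.baseChange K).torsionGaloisModule (p : ℤ)) v)) =
            ((W.isQuotientBy_eisensteinDVRSetting_πbar (κ.unitTwist (-1)) hm S hpS hbad L hL hLS jbar'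
              (ConjugationDatum.ofLifts σ hσ₁ hσ _ hτl hτ₂) D
              (W.eisensteinLevelsTameFs (κ.unitTwist (-1)) hm π S hpS hbad L hL hLS)
              k).propagateStructure (W.eisensteinTowerTriple (κ.unitTwist (-1)) hm S hpS hbad L hL hLS k).cond)
              (Sum.inr v) :=
  h5bAtS_frame_of_clauseZeroP N W K p κ γ hyp _hirr _hirrK S hpS hbad hSN hSσ
    (clauseZeroP_frame_of_nonanomalous N W K p κ γ hyp _hirr _hirrK S hpS hbad hSN hSσ NA0 NA2)

end Summit.BirchSwinnertonDyer.BirchSwinnertonDyer.Theorems.HeegnerMuPartH5bAtS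

end
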